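import Summits.BirchSwinnertonDyer.Rank1Residual.AdditivePotMult.TwistSupply
import Summits.BirchSwinnertonDyer.Rank1Residual.Additive.GordRankZeroChiBranch
import Summits.BirchSwinnertonDyer.Rank1Residual.Additive.RamifiedTwistConductor
import Summits.BirchSwinnertonDyer.Rank1Residual.Additive.GordIsogenyInvariance
import Literature.NumberTheory.EllipticCurves.ManinConstantQuadraticTwistIstarProofs
import Literature.NumberTheory.EllipticCurves.SkinnerUrban2014.PAdicUnitPeriodRatioAnyPrimeProofs
import Literature.NumberTheory.Automorphic.ShimuraCurveRibetTakahashiOptimalModularityProofs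
import Literature.NumberTheory.EllipticCurves.NonEisensteinPrimeOfSurjective
import Literature.NumberTheory.EllipticCurves.NoEverywhereGoodReductionRat
import Literature.NumberTheory.EllipticCurves.RootNumberProofs
import Literature.NumberTheory.EllipticCurves.AnalyticIsogenyDescentProofs
import Literature.NumberTheory.EllipticCurves.ModularCurveNeronLatticeProofs
import HarnessLib

/-!
# Route `QuadraticBranchSignedControl` (rung K8, cell `bsd-potss`), crux `PlusEtaLowerInclusion`
# (item stmt-BirchSwinnertonDyer-19601): THE MANIN INPUT OF THE KURIHARA CUT IS A THEOREM — `p ∤ c`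
# and the `p`-adic unit period transfer for EVERY globally minimal partner of a tower-onto Gss2 pair,
# from Stevens' twisting argument (a tree theorem) and four published Manin-constant facts
# (a `--supports` file; seat `bsd-potss-k8eta-c1`, gen 9)

HONEST FRAMING (cell `bsd-potss`, run/shared/lean/pub/bsd-potss/; FULL-BSD rank ≤ 1 programme,
tranche 1b, HUMAN RULING D-0036/D-0074; verbatim in every file): the target of record is FULL BSD for
every analytic-rank ≤ 1 curve over `ℚ`; this cell attacks rows B4/B5/B8 (additive potentially
supersingular primes). Crux 19601 `PlusEtaLowerInclusion` — Kobayashi's Eisenstein (lower) inclusion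
of the even main conjecture at `η = ω^{(p−1)/2}` for every good supersingular `a_p(V) = 0` twist `V/ℚ`,
`p ≥ 5`, whose `p`-adic tower is onto = Kato's lower IMC inclusion for the ADDITIVE partner
`W = V ⊗ χ_{p*}` — is OPEN class-wide and in print for no non-CM `V`. THIS FILE closes nothing, books
nothing and claims `BSD(W, p)` for no pair.

WHAT. Skeleton v5 of the crux (planner g26; the KURIHARA CUT over p599308) carries the Σ₁ stub
`stub_etaLower_kurihara_tamFree`: every Tamagawa-`p`-free tower-onto partner `W` has (K2a) a modular
parametrisation datum `D` with `p ∤ c_D` and a `p`-unit period transfer `Ω(W) = u · Ω⁺_{D.f}` AND (K2b) a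
unit Kurihara number of `D.f`. p599308 §3 labels (K2a) «Cremona for `N < 500000`, open beyond at a prime
of additive reduction». IT IS NOT OPEN: `W` is the `p*`-twist of a curve GOOD at `p` (type `I₀*`), and
for this situation the tree PROVES `not_dvd_maninConstant_of_isSemistableAt_quadraticTwist_pStar`
(`ManinConstantQuadraticTwistIstarProofs.lean`: `q ∤ c₀` for the lattice-optimal datum at every ODD `q`,
`q² ∣ N`, with `W ⊗ χ_{q*}` semistable at `q` — Stevens 1989 Lemmas (5.2)/(5.4) on `Γ₀`, a tree
theorem, plus the NAMED FACTS `hM` Mazur 1978 Cor. 4.1, `hAU` Abbes–Ullmo 1996 Thm. A, `hC2`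
Česnavičius 2018 Thm. 1.2, `hnf` modularity; Edixhoven 1991 §1 credits the `I₀*` clause to "Mazur and
Stevens"). This file reads it in the K8 frame and adds the two transports the cut needs:

* §0: `W ⊗ χ_{p*}` is good at the place of `p` when `C • W^{(p*)} = V`, `V` good at `p`; `p² ∣ N(W)`.
* §1 `not_dvd_maninConstant_of_quadraticBranch_of_latticeOptimal`: `p ∤ c(D)` for a lattice-optimal
  datum of the partner `W` itself (odd `p`); §2 the same for a lattice-optimal datum of ANY globally
  minimal `W₀` isogenous to `W` (`W₀ ⊗ χ_{p*} ∼ W ⊗ χ_{p*} ≅ V` is good at `p`).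
* §3 a datum with PRESCRIBED integral multiplier (the construction of
  `ModularParametrizationData.nonempty_of_isNewformOf`, witnesses exposed); the Néron scaling of an
  isogeny `ψ : W → W₀` (`q' ∣ deg ψ` with `q' Λ_{W₀} ⊆ Λ_W`); and the ISOGENY TRANSPORT
  `exists_modularParametrizationData_not_dvd_of_isogenous` (`E[p]` irreducible, `W₀ ∼ W`, `p ∤ c(D₀)`
  ⟹ a datum `D` of `W`, same newform, `p ∤ c(D) = q' c(D₀)`) — the gen-8 memo's "isogeny caveat", now
  a theorem.
The companion file `…PlusEtaLowerInclusionKuriharaCutManinFree.lean` (same seat) assembles these into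
§4 `maninInput_of_quadraticBranch` — for EVERY K8 partner (`p` odd, `ρ̄_{W,p}` onto) a datum `D` of `W`
with `p ∤ c(D)` and `Ω(W) = u · Ω⁺_{D.f}`, `‖u‖_p = 1`, VERBATIM the binder `hManin` of p599308 §3,
modulo `hM hAU hC2 hnf` only — and feeds it into the cut: `PlusEtaLowerInclusion` ⟸ Kim 1.11_η +
`hM hAU hC2 hnf` + Kurihara's conjecture mod `p` on the Tamagawa-free partners (K2b) + the Tamagawa rows
(K3); i.e. the OPEN content of the registered stub `stub_etaLower_kurihara_tamFree` is (K2b) ALONE.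

TRUST BASE: Mazur 1978 Cor. 4.1, Abbes–Ullmo 1996 Thm. A, Česnavičius 2018 Thm. 1.2, BCDT 2001
(the tree's named facts `mazur_not_dvd_maninConstant_of_odd`, `abbesUllmo_not_dvd_maninConstant_of_not_dvd_level`,
`cesnavicius_not_two_dvd_maninConstant_of_two_dvd_level`, `exists_isNewformOf`) — all refereed print;
everything else (Stevens' lemmas, Edixhoven's integrality Prop. 2, Néron scaling, optimal datum,
uniformisation, modular degree, Greenberg–Vatsal's period remark, Tate's algorithm for `I₀*`) is a
THEOREM of the tree. HONEST LABEL: a CONDITIONAL discharge of ONE displayed binder of the cut (named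
facts in hypothesis position); the crux, (K2b), (K3), (E⁺_η) and BSD are exactly as open as before;
no census row moves (the 20 (K2)-rows' records already displayed Cremona's datum); nothing is booked.

References: [Stevens1989] Lemmas (5.2), (5.4); [Mazur1978] Cor. 4.1; [AbbesUllmo1996] Thm. A;
[Cesnavicius2018] Thm. 1.2; [EdixhovenManin1991] §1, Prop. 2; [GreenbergVatsal2000] §3 Remark 3.4;
[SilvermanAEC2009] VI.4.1, Cor. VII.7.2; [Kim2022StructureSelmer] §1.3.5 (the Manin hypothesis of Thm. 1.11).
-/

set_option autoImplicit false
-- sibling precedent (`…PlusEtaLowerInclusionKuriharaCut.lean`): the directory name repeats the summit name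
set_option linter.dupNamespace false

noncomputable section

open scoped Classical MatrixGroups ModularForm

namespace Summit.BirchSwinnertonDyer.BirchSwinnertonDyer.Theorems.PlusEtaManinInput

open CongruenceSubgroup WeierstrassCurve IsDedekindDomain Rat.HeightOneSpectrum
  Literature.NumberTheory.EllipticCurves
  Literature.NumberTheory.EllipticCurves.ModularForms
  Literature.NumberTheory.EllipticCurves.Rank1Residual
  Literature.NumberTheory.Automorphic
  Summit.BirchSwinnertonDyer.Rank1Residual
  Summit.BirchSwinnertonDyer.Rank1Residual.Additive

/-! ## §0 Bookkeeping: the twist parameter `p*`, good reduction of `W ⊗ χ_{p*}` at `p`, `p² ∣ N(W)` -/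

/-- `p* = p` or `p* = −p`. [folklore] -/
theorem pStar_eq_or (p : ℕ) : ((-1 : ℚ) ^ (p / 2) * p) = p ∨ ((-1 : ℚ) ^ (p / 2) * p) = -p := by
  rcases neg_one_pow_eq_or ℚ (p / 2) with h | h
  · exact Or.inl (by rw [h, one_mul])
  · exact Or.inr (by rw [h, neg_one_mul])

/-- **`W ⊗ χ_{p*}` has good reduction at the place of `p`** when `C • W^{(p*)} = V` with `V` good at
`p`: good reduction is invariant under a change of variables over `ℚ`
(`hasGoodReductionAtPrime_iff_of_variableChange`) and the prime-indexed and place-indexed predicates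
agree (`hasGoodReductionAtPrime_iff_hasGoodReductionAt_holds`).
[cite: SilvermanAEC2009, VII.5 Prop. 5.1(a) (PDF p. 174)] -/
theorem hasGoodReductionAt_quadraticTwist_pStar_of_model {V W : WeierstrassCurve ℚ}
    (C : VariableChange ℚ) (p : ℕ) [hp : Fact p.Prime]
    (hCV : C • W.quadraticTwist ((-1) ^ (p / 2) * p) = V) (hgood : V.HasGoodReductionAtPrime p) :
    (W.quadraticTwist (((-1 : ℤ) ^ (p / 2) * p : ℤ) : ℚ)).HasGoodReductionAt
      ((primesEquiv (R := ℤ)).symm ⟨p, hp.out⟩) := by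
  have h1 : (W.quadraticTwist ((-1 : ℚ) ^ (p / 2) * p)).HasGoodReductionAtPrime p := by
    rw [← WeierstrassCurve.hasGoodReductionAtPrime_iff_of_variableChange _ C, hCV]; exact hgood
  have e : ((((-1 : ℤ) ^ (p / 2) * p : ℤ)) : ℚ) = (-1 : ℚ) ^ (p / 2) * p := by push_cast; rfl
  rw [e]
  exact ((W.quadraticTwist ((-1 : ℚ) ^ (p / 2) * p)).hasGoodReductionAtPrime_iff_hasGoodReductionAt_holds
    ⟨p, hp.out⟩).mp h1

/-- **`p² ∣ N(W)`** for a globally minimal partner: `C • W^{(p*)} = V`, `V` globally minimal and good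
at the odd prime `p` ⟹ `f_p(W) = 2` (Kodaira type `I₀*`; tree theorem `condExpTwo_of_twist_pm_p`
applied to `C' • V^{(p*)} = W`, the twist involution on models) ⟹ `p² ∣ N(W)`.
[cite: SilvermanATAEC1994, IV.10.4] -/
theorem sq_dvd_conductorNorm_of_model {V W : WeierstrassCurve ℚ} [V.IsElliptic] [V.IsGloballyMinimal]
    [W.IsElliptic] [W.IsGloballyMinimal] (C : VariableChange ℚ) (p : ℕ) [hp : Fact p.Prime]
    (hp2 : p ≠ 2) (hCV : C • W.quadraticTwist ((-1) ^ (p / 2) * p) = V)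
    (hgood : V.HasGoodReductionAtPrime p) : p ^ 2 ∣ W.conductorNorm ℤ := by
  obtain ⟨C', hC'⟩ := exists_variableChange_twist_of_model_twist W
    (mul_ne_zero (pow_ne_zero _ (by norm_num)) (by exact_mod_cast (Fact.out : p.Prime).ne_zero)) hCV
  have h2 : CondExpTwo W p :=
    condExpTwo_of_twist_pm_p p hp2 V (Or.inl hgood) (pStar_eq_or p) C' hC'
  have hN0 : W.conductorNorm ℤ ≠ 0 := (WeierstrassCurve.conductorNorm_pos_holds W).ne'
  have hfac : (W.conductorNorm ℤ).factorization p = 2 := by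
    have h := factorization_conductorNorm_primesEquiv_symm W ⟨p, hp.out⟩
    rw [h]; exact h2
  exact (hp.out.pow_dvd_iff_le_factorization hN0).mpr hfac.ge

/-! ## §1 `p ∤ c` for a lattice-optimal parametrisation datum of a K8 partner (Stevens' twisting argument) -/

/-- **The Manin constant of the optimal parametrisation of a K8 partner is prime to `p`.** Modulo
`hM hAU hC2 hnf`: `p` ODD, `V/ℚ` globally minimal and good at `p`, `W/ℚ` globally minimal with
`C • W^{(p*)} = V`, `D` a LATTICE-OPTIMAL datum of `W` (`Λ_W = c Λ_f`: `W` is the `X₀(N)`-optimal curve,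
`φ_D` its optimal parametrisation) ⟹ `p ∤ c(D)` — the tree theorem
`not_dvd_maninConstant_of_isSemistableAt_quadraticTwist_pStar` in the K8 frame (`W ⊗ χ_{p*} ≅ V` GOOD at
`p`; `p² ∣ N(W)` by §0). No conductor bound, no Cremona table.
[cite: Stevens1989, Lemmas (5.2), (5.4)] [cite: Mazur1978, Cor. 4.1] [cite: Cesnavicius2018, Thm. 1.2]
[cite: EdixhovenManin1991, §1 ("Mazur and Stevens", type I₀*)] -/
theorem not_dvd_maninConstant_of_quadraticBranch_of_latticeOptimal
    (hM : mazur_not_dvd_maninConstant_of_odd)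
    (hAU : abbesUllmo_not_dvd_maninConstant_of_not_dvd_level)
    (hC2 : cesnavicius_not_two_dvd_maninConstant_of_two_dvd_level)
    (hnf : exists_isNewformOf)
    {V : WeierstrassCurve ℚ} [V.IsElliptic] [V.IsGloballyMinimal]
    {W : WeierstrassCurve ℚ} [W.IsElliptic] [W.IsGloballyMinimal]
    (C : VariableChange ℚ) (p : ℕ) [hp : Fact p.Prime] (hp2 : p ≠ 2)
    (hCV : C • W.quadraticTwist ((-1) ^ (p / 2) * p) = V) (hgood : V.HasGoodReductionAtPrime p)
    {N : ℕ} [NeZero N] (D : ModularParametrizationData W N)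
    (hopt : ∀ z ∈ D.L.lattice, ∃ w ∈ periodLattice D.f, z = D.c * w) :
    ¬ (p : ℤ) ∣ D.maninConstant := by
  have hN : N = W.conductorNorm ℤ :=
    IsNewformOf.level_eq_conductorNorm_of_exists_isNewformOf hnf D.isNewformOf
  have hsq : p ^ 2 ∣ N := hN ▸ sq_dvd_conductorNorm_of_model C p hp2 hCV hgood
  exact not_dvd_maninConstant_of_isSemistableAt_quadraticTwist_pStar hM hAU hC2 hnf D hopt hp.out hp2
    hsq (Or.inl (hasGoodReductionAt_quadraticTwist_pStar_of_model C p hCV hgood))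

/-! ## §2 The same for every globally minimal member of the isogeny class of the partner -/

/-- **`p ∤ c₀` for the lattice-optimal datum on ANY globally minimal member `W₀` of the isogeny class
of a K8 partner `W`.** The twist `W₀ ⊗ χ_{p*}` is isogenous to `W ⊗ χ_{p*} ≅ V`
(`IsIsogenous.quadraticTwist`), so it is good at `p` (Silverman Cor. VII.7.2,
`hasGoodReductionAtPrime_iff_of_isIsogenous`); a global minimal model `V₀` of `W₀ ⊗ χ_{p*}`
(`AdditivePotMult.exists_globallyMinimal_model_twist`) puts `(V₀, W₀)` in the K8 frame and §1 applies.
Same four named facts. [cite: Stevens1989, Lemmas (5.2), (5.4)] [cite: SilvermanAEC2009, Cor. VII.7.2]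
[cite: Cesnavicius2018, Thm. 1.2] [cite: Mazur1978, Cor. 4.1] -/
theorem not_dvd_maninConstant_of_quadraticBranch_of_isogenous_latticeOptimal
    (hM : mazur_not_dvd_maninConstant_of_odd)
    (hAU : abbesUllmo_not_dvd_maninConstant_of_not_dvd_level)
    (hC2 : cesnavicius_not_two_dvd_maninConstant_of_two_dvd_level)
    (hnf : exists_isNewformOf)
    {V : WeierstrassCurve ℚ} [V.IsElliptic] [V.IsGloballyMinimal]
    {W : WeierstrassCurve ℚ} [W.IsElliptic] [W.IsGloballyMinimal]
    (C : VariableChange ℚ) (p : ℕ) [hp : Fact p.Prime] (hp2 : p ≠ 2)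
    (hCV : C • W.quadraticTwist ((-1) ^ (p / 2) * p) = V) (hgood : V.HasGoodReductionAtPrime p)
    {W₀ : WeierstrassCurve ℚ} [W₀.IsElliptic] [W₀.IsGloballyMinimal] (hiso : IsIsogenous W W₀)
    {N : ℕ} [NeZero N] (D₀ : ModularParametrizationData W₀ N)
    (hopt₀ : ∀ z ∈ D₀.L.lattice, ∃ w ∈ periodLattice D₀.f, z = D₀.c * w) :
    ¬ (p : ℤ) ∣ D₀.maninConstant := by
  have hd : ((-1 : ℚ) ^ (p / 2) * p) ≠ 0 :=
    mul_ne_zero (pow_ne_zero _ (by norm_num)) (by exact_mod_cast (Fact.out : p.Prime).ne_zero)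
  haveI : NeZero (2 : ℚ) := ⟨two_ne_zero⟩
  -- a global minimal model `V₀` of `W₀ ⊗ χ_{p*}`
  obtain ⟨V₀, _, _, C₀, hC₀⟩ := AdditivePotMult.exists_globallyMinimal_model_twist W₀ hd
  -- `V₀` is good at `p`: `V₀ ≅ W₀^{(p*)} ~ W^{(p*)} ≅ V`
  haveI := W.isElliptic_quadraticTwist hd
  haveI := W₀.isElliptic_quadraticTwist hd
  have h1 : (W.quadraticTwist ((-1 : ℚ) ^ (p / 2) * p)).HasGoodReductionAtPrime p := by
    rw [← WeierstrassCurve.hasGoodReductionAtPrime_iff_of_variableChange _ C, hCV]; exact hgood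
  have h2 : (W₀.quadraticTwist ((-1 : ℚ) ^ (p / 2) * p)).HasGoodReductionAtPrime p :=
    (hasGoodReductionAtPrime_iff_of_isIsogenous (hiso.quadraticTwist hd) p).mp h1
  have hgood₀ : V₀.HasGoodReductionAtPrime p := by
    rw [← hC₀, WeierstrassCurve.hasGoodReductionAtPrime_iff_of_variableChange]; exact h2
  exact not_dvd_maninConstant_of_quadraticBranch_of_latticeOptimal hM hAU hC2 hnf C₀ p hp2 hC₀ hgood₀
    D₀ hopt₀


/-! ## §3 A parametrisation datum with a PRESCRIBED integral multiplier, and its isogeny transport with `p ∤ c` -/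

/-- **A modular parametrisation datum of `W` at level `N` with prescribed newform `f`, Néron pair `L`
and integral multiplier `c`** (`c ≠ 0`, `c Λ_f ⊆ Λ_L`): the uniformisation `ℂ/Λ_L ≅ E(ℂ)` (Silverman
AEC VI.3.6 (b), `IsNeronLatticeOf.exists_uniformize_holds`) and the degree of
`Γ₀(N)τ ↦ c · 2πi ∫_{i∞}^τ f (mod Λ_L)` (`exists_modularDegree_holds`) are theorems of the tree — the
construction of `ModularParametrizationData.nonempty_of_isNewformOf`, here with the witnesses
`D.f = f`, `D.L = L`, `D.c = c` EXPOSED (the consumer below needs `D.c`).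
[cite: BCDTJAMS2001, Thm. A with (6) of p. 845] [cite: SilvermanAEC2009, VI.3.6 (b) and VI.5.1] -/
theorem exists_modularParametrizationData_eq_of_smul_periodLattice_le {W : WeierstrassCurve ℚ}
    [W.IsElliptic] {N : ℕ} [NeZero N] {f : CuspForm (Gamma0 N) 2} (hf : IsNewformOf W f)
    {L : PeriodPair} (hL : IsNeronLatticeOf (W.baseChange ℂ) L) {c : ℤ} (hc0 : c ≠ 0)
    (hc : ∀ z ∈ periodLattice f, (c : ℂ) * z ∈ L.lattice) :
    ∃ D : ModularParametrizationData W N, D.f = f ∧ D.L = L ∧ D.c = c := by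
  haveI : (W.baseChange ℂ).IsElliptic := by rw [WeierstrassCurve.baseChange]; infer_instance
  obtain ⟨u, hker, hsurj, hspec⟩ := IsNeronLatticeOf.exists_uniformize_holds hL
  obtain ⟨d, hd, hfin⟩ := exists_modularDegree_holds hf.1.ne_zero (L := L) (c := (c : ℂ))
    (Int.cast_ne_zero.mpr hc0) hc
  -- transport the exceptional set along `ℂ/Λ_L ≃ E(ℂ)`
  have hker' : L.lattice.toAddSubgroup = u.ker :=
    SetLike.coe_injective (by rw [Submodule.coe_toAddSubgroup, hker])
  let e : ℂ ⧸ L.lattice.toAddSubgroup ≃+ (W.baseChange ℂ).toAffine.Point :=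
    QuotientAddGroup.liftEquiv L.lattice.toAddSubgroup hsurj hker'
  have he : ∀ x : ℂ, e.toEquiv (x : ℂ ⧸ L.lattice.toAddSubgroup) = u x := fun _ ↦ rfl
  have key := (finite_setOf_card_fiberOrbits_ne_iff e.toEquiv
    (fun τ : UpperHalfPlane ↦
      (((c : ℂ) * eichlerIntegral f τ : ℂ) : ℂ ⧸ L.lattice.toAddSubgroup)) d).mpr hfin
  simp only [he] at key
  exact ⟨{ f := f
           isNewformOf := hf
           L := L
           isNeronLattice := hL
           uniformize := u
           ker_uniformize := hker
           uniformize_surjective := hsurj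
           uniformize_spec := hspec
           c := c
           smul_periodLattice_le := hc
           deg := d
           deg_pos := hd
           deg_spec := key }, rfl, rfl, rfl⟩

/-- **Néron scaling of an isogeny, integral form.** For a `ℚ`-isogeny `ψ : W → W₀` of degree `d`
between GLOBALLY MINIMAL elliptic curves with Néron-type period pairs `L = Λ_W`, `L₀ = Λ_{W₀}`, there
is an integer `q' ≠ 0` with `q' ∣ d` and `q' · Λ_{W₀} ⊆ Λ_W`: `ψ` is `z ↦ r z` with `r Λ_W ⊆ Λ_{W₀}` of
index `d` (`exists_rat_mulLeft_lattice_le_of_isogeny`), so `(d/r) Λ_{W₀} ⊆ Λ_W`, and `r`, `d/r` are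
integers by Néron integrality (`integral_neronScaling_of_isGloballyMinimal_holds`) — the bookkeeping
of `SkinnerUrban2014.exists_int_mul_realPeriodRat_eq_of_isogeny`, here for the full complex lattices.
[cite: GreenbergVatsal2000, §3, Remark 3.4] [cite: SilvermanAEC2009, Thm. VI.4.1(b)] -/
theorem exists_int_dvd_degree_mul_mem_lattice {W W₀ : WeierstrassCurve ℚ} [W.IsElliptic]
    [W₀.IsElliptic] [W.IsGloballyMinimal] [W₀.IsGloballyMinimal] {L L₀ : PeriodPair}
    (hL : IsNeronLatticeOf (W.baseChange ℂ) L) (hL₀ : IsNeronLatticeOf (W₀.baseChange ℂ) L₀)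
    (ψ : Isogeny W W₀) :
    ∃ q' : ℤ, q' ∣ (ψ.degree : ℤ) ∧ ∀ z ∈ L₀.lattice, (q' : ℂ) * z ∈ L.lattice := by
  -- adapted from `SkinnerUrban2014.exists_int_mul_realPeriodRat_eq_of_isogeny` (first half)
  obtain ⟨r, hr0, hle, hidx⟩ := exists_rat_mulLeft_lattice_le_of_isogeny W W₀ hL hL₀ ψ
  set d : ℕ := ψ.degree with hd
  have hr0' : (r : ℚ) ≠ 0 := by
    rintro rfl
    exact hr0 (by push_cast; rfl)
  -- `rΛ ⊆ Λ₀`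
  have hmem : ∀ z ∈ L.lattice, ((r : ℚ) : ℂ) * z ∈ L₀.lattice := fun z hz ↦
    hle (PeriodPair.mul_mem_mulLeft_lattice.mpr hz)
  -- `r ∈ ℤ`
  obtain ⟨q, hq⟩ := integral_neronScaling_of_isGloballyMinimal_holds W W₀ L L₀ hL hL₀ r hmem
  -- `(d/r)Λ₀ ⊆ Λ`
  have hdmem : ∀ z ∈ L₀.lattice, ((d / r : ℚ) : ℂ) * z ∈ L.lattice := by
    intro z hz
    have h1 : d • z ∈ (L.mulLeft (r : ℂ) hr0).lattice := by
      have h2 := AddSubgroup.nsmul_relIndex_mem (L.mulLeft (r : ℂ) hr0).lattice.toAddSubgroup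
        (K := L₀.lattice.toAddSubgroup) (g := z) hz
      rw [hidx] at h2
      exact h2
    rw [PeriodPair.mem_mulLeft_lattice, nsmul_eq_mul] at h1
    have e : ((d / r : ℚ) : ℂ) * z = ((r : ℚ) : ℂ)⁻¹ * ((d : ℂ) * z) := by
      push_cast
      ring
    rw [e]
    exact h1
  obtain ⟨q', hq'⟩ := integral_neronScaling_of_isGloballyMinimal_holds W₀ W L₀ L hL₀ hL (d / r) hdmem
  have hqq' : q * q' = d := by
    have h : (q : ℚ) * q' = d := by
      rw [hq, hq']
      field_simp
    exact_mod_cast h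
  refine ⟨q', ⟨q, by rw [← hqq', mul_comm]⟩, fun z hz ↦ ?_⟩
  have h := hdmem z hz
  rwa [← hq', Rat.cast_intCast] at h

/-- **ISOGENY TRANSPORT of the Manin input (the gen-8 "isogeny caveat", now a theorem).** `W/ℚ`
globally minimal with newform `f ∈ S₂(Γ₀(N))` and `E[p]` IRREDUCIBLE, `W₀ ∼ W` globally minimal with a
datum `D₀` at level `N`, `D₀.f = f`, `p ∤ c(D₀)` ⟹ `W` carries a datum `D` at level `N` with `D.f = f` and
`p ∤ c(D)`: an isogeny `ψ : W → W₀` of degree prime to `p` exists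
(`exists_isogeny_not_dvd_degree_of_irreducible`), its Néron scaling gives `q' ∣ deg ψ` with
`q' Λ_{W₀} ⊆ Λ_W`, and `c := q' · c(D₀)` has `c Λ_f ⊆ Λ_W`, `p ∤ c`. (In print: the Manin constant of a
non-optimal curve is `c₀` times the Néron pull-back scalar of an isogeny from the optimal curve, a
divisor of its degree.) [cite: GreenbergVatsal2000, §3, Remark 3.4] [cite: EdixhovenManin1991, §1]
[cite: SilvermanAEC2009, Thm. VI.4.1(b)] -/
theorem exists_modularParametrizationData_not_dvd_of_isogenous {W W₀ : WeierstrassCurve ℚ}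
    [W.IsElliptic] [W.IsGloballyMinimal] [W₀.IsElliptic] [W₀.IsGloballyMinimal] {N : ℕ} [NeZero N]
    {f : CuspForm (Gamma0 N) 2} (hf : IsNewformOf W f) (p : ℕ) [hp : Fact p.Prime]
    (hirr : W.HasIrreducibleModPGaloisRep p) (hiso : IsIsogenous W W₀)
    (D₀ : ModularParametrizationData W₀ N) (hf₀ : D₀.f = f) (hc₀ : ¬ (p : ℤ) ∣ D₀.maninConstant) :
    ∃ D : ModularParametrizationData W N, D.f = f ∧ ¬ (p : ℤ) ∣ D.maninConstant := by
  haveI : (W.baseChange ℂ).IsElliptic := by rw [WeierstrassCurve.baseChange]; infer_instance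
  obtain ⟨L, hL⟩ := exists_isNeronLatticeOf_holds (W.baseChange ℂ)
  obtain ⟨ψ, hψ⟩ := SkinnerUrban2014.exists_isogeny_not_dvd_degree_of_irreducible (W := W) (W' := W₀)
    (Nat.cast_ne_zero.mpr hp.out.ne_zero) hirr hiso
  obtain ⟨q', hq'd, hq'mem⟩ := exists_int_dvd_degree_mul_mem_lattice hL D₀.isNeronLattice ψ
  have hpq' : ¬ (p : ℤ) ∣ q' := fun h ↦ hψ (Int.natCast_dvd_natCast.mp (h.trans hq'd))
  have hpP : Prime (p : ℤ) := Nat.prime_iff_prime_int.mp hp.out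
  have hc0' : D₀.c ≠ 0 := fun h ↦ hc₀ (by
    change (p : ℤ) ∣ D₀.c
    rw [h]; exact dvd_zero _)
  have hq'0 : q' ≠ 0 := fun h ↦ hpq' (by rw [h]; exact dvd_zero _)
  have hc : ∀ z ∈ periodLattice f, ((q' * D₀.c : ℤ) : ℂ) * z ∈ L.lattice := by
    intro z hz
    have h1 : (D₀.c : ℂ) * z ∈ D₀.L.lattice := D₀.smul_periodLattice_le z (hf₀ ▸ hz)
    have h2 := hq'mem _ h1
    rwa [← mul_assoc, ← Int.cast_mul] at h2
  obtain ⟨D, hDf, -, hDc⟩ :=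
    exists_modularParametrizationData_eq_of_smul_periodLattice_le hf hL (mul_ne_zero hq'0 hc0') hc
  refine ⟨D, hDf, fun h ↦ ?_⟩
  change (p : ℤ) ∣ D.c at h
  rw [hDc] at h
  rcases hpP.dvd_or_dvd h with h | h
  · exact hpq' h
  · exact hc₀ h

end Summit.BirchSwinnertonDyer.BirchSwinnertonDyer.Theorems.PlusEtaManinInput

end
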